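import Literature.NumberTheory.GaloisRepresentations.SemiLocalArchimedeanDecomposition
import Literature.NumberTheory.GaloisRepresentations.UnitIdelesHerbrand
import Literature.NumberTheory.GaloisRepresentations.LocalGaloisModel
import HarnessLib

/-!
# The distinguished infinite place `w_v ∣ v` cut out by `K̄ → K̄_v` and the `K_v`-embedding `E_{w_v} → K̄_v`
# extending `ι_v ∘ ιE` (Cassels–Fröhlich VII §1.1 at the archimedean places; Neukirch II (8.1)–(8.3))

Topic `NumberTheory/GaloisRepresentations`; namespace `Literature.NumberTheory.GaloisRepresentations.IdeleReadout`
(`ArchHerbrand` and the scoped `NumberField.LiesOver` algebra structures are opened).  Definitions with bodies (CHOICES,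
packaged) and theorems; NO named fact, no `sorry`, no instance, no notation; number fields in `Type`.  The archimedean
twin of door-c5 g17's `CompletionCompositumEmbedding.lean`, obtained from the engine `LocalGaloisModel.lean`.

Why (Route A of crux `AnticycControlAdditiveK`, item 19295; door-c6 g16 presentation road, (R-def)/(R3) at the
INFINITE places).  For a finite Galois `E/K` with `ιE : E → K̄` and an infinite place `v` of `K`, the readout at `v`
of an idèle-valued homomorphism and its assembly from local data need ONE infinite place `w_v ∣ v` of `E` and an
embedding `E_{w_v} → K̄_v` (`K̄_v = AlgebraicClosure K_v`, `K_v = v.Completion`) extending `ι_v ∘ ιE`, on which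
`Γ_{K_v}` acts through the decomposition group `Stab(w_v)`.  Construction: take any `w₀ ∣ v` (`ArchHerbrand.placeOver`)
and any `K_v`-embedding `φ₀ : E_{w₀} → K̄_v` (`IsAlgClosed.lift`; `E_{w₀}/K_v` is finite Galois, door-c6
`ArchHerbrand.isGalois_completion`); the two `K`-embeddings `φ₀|_E` and `ι_v ∘ ιE` of the normal `E` differ by
`σ ∈ Gal(E/K)` (`φ₀ e = ι_v ιE (σ e)`); put `w_v := σ • w₀` and `archPlaceEmb := φ₀ ∘ (σ⁻¹)_{w_v}` (Galois transport of
completions, `galInfiniteCompletionMap`, `K_v`-linear by density of `K`).  The equivariance, the surjectivity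
`Γ_{K_v} ↠ Stab(w_v)` and the image characterisation are the engine `LocalModel` fed with `δ = ArchHerbrand.archDecompHom`
(bijective: `archDecompMulEquiv`).

## What is formalised (`K E : Type`, `[IsGalois K E]`, `ιE : E →ₐ[K] K̄`, `v : InfinitePlace K`)

* §1 `galInfiniteCompletionMap_algebraMap_of_isOver` (Galois transport between completions at two places over `v` is
  `K_v`-linear), `archBasePlace`, `archBaseEmb`, `exists_algEquiv_archBaseEmb_eq`.
* §2 **`archEmbPlace v ιE : InfinitePlace E`** (`w_v`), `isOver_archEmbPlace`, `liesOver_archEmbPlace`,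
  **`archPlaceEmb v ιE : E_{w_v} →+* K̄_v`**, `archPlaceEmb_algebraMap'` (`K_v`-linear),
  **`archPlaceEmb_coe`** (`archPlaceEmb e = ι_v (ιE e)`), `archPlaceEmb_injective`.
* §3 (engine) **`galRestrictField_smul_archEmbPlace`** (`d|_E ∈ Stab(w_v)`), `archGalRestrictStab` (+ `_surjective`),
  **`archPlaceEmb_galInfiniteCompletionMap`** (`archPlaceEmb (g_{w_v} y) = d • archPlaceEmb y` for `g = d|_E`),
  `smul_archPlaceEmb_of_galRestrictField_eq_one`, **`exists_archPlaceEmb_eq_of_forall_smul`**.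

## References
* J. W. S. Cassels, A. Fröhlich (eds.), *Algebraic Number Theory* (1967), Ch. VII (Tate) §1.1, Prop. 1.2. [CasselsFrohlichANT1967]
* J. Neukirch, *Algebraic Number Theory* (1999), Ch. II (8.1)–(8.3). [NeukirchANT1999]
* D. Harari, *Galois Cohomology and Class Field Theory* (2020), §13.1. [Harari2020]
-/

noncomputable section

open NumberField NumberField.InfinitePlace Field
open Literature.NumberTheory.Automorphic
open scoped NumberField.LiesOver

namespace Literature.NumberTheory.GaloisRepresentations

namespace IdeleReadout

open ArchHerbrand

variable {K : Type} [Field K] {E : Type} [Field E] [Algebra K E] [FiniteDimensional K E] [IsGalois K E]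
variable (v : InfinitePlace K) (ιE : E →ₐ[K] AlgebraicClosure K)

/-! ## §1. Galois transport between completions over `v` is `K_v`-linear; a base place and a base embedding -/

omit [FiniteDimensional K E] [IsGalois K E] in
/-- `LiesOver` from `IsOver` (the scoped `K_v`-algebra structure on `E_w` becomes available). [cite: CasselsFrohlichANT1967, Ch. VII §1.1] -/
theorem liesOver_of_isOver {w : InfinitePlace E} (hw : IsOver E v w) : w.1.LiesOver v.1 :=
  ⟨congrArg Subtype.val hw⟩

omit [FiniteDimensional K E] [IsGalois K E] in
/-- **The Galois transport `τ_w : E_w → E_{w'}` (`τ • w = w'`, both over `v`) is `K_v`-linear** (it fixes `K`, hence `K_v`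
by density and continuity). [cite: CasselsFrohlichANT1967, Ch. VII §1.1] -/
theorem galInfiniteCompletionMap_algebraMap_of_isOver (τ : E ≃ₐ[K] E) {w w' : InfinitePlace E} (h : τ • w = w')
    [hw : w.1.LiesOver v.1] [hw' : w'.1.LiesOver v.1] (x : v.Completion) :
    galInfiniteCompletionMap τ h (algebraMap v.Completion w.Completion x) = algebraMap v.Completion w'.Completion x := by
  induction x using InfinitePlace.Completion.induction_on with
  | hp =>
    exact isClosed_eq ((continuous_galInfiniteCompletionMap K _ _).comp NumberField.LiesOver.continuous_completionMap)
      NumberField.LiesOver.continuous_completionMap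
  | ih a =>
    rw [InfinitePlace.Completion.algebraMap_coe, InfinitePlace.Completion.algebraMap_coe]
    change galInfiniteCompletionMap τ h ((algebraMap K E a.ofAbs : E) : w.Completion) =
      ((algebraMap K E a.ofAbs : E) : w'.Completion)
    rw [galInfiniteCompletionMap_coe, AlgEquiv.commutes]

/-- A base place `w₀ ∣ v` (the tree's `ArchHerbrand.placeOver`). [cite: CasselsFrohlichANT1967, Ch. VII §1.1] -/
def archBasePlace : InfinitePlace E := placeOver E v

omit [FiniteDimensional K E] in
/-- `w₀ ∣ v`. [cite: CasselsFrohlichANT1967, Ch. VII §1.1] -/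
theorem isOver_archBasePlace : IsOver E v (archBasePlace (E := E) v) := isOver_placeOver v

/-- **A `K_v`-embedding `φ₀ : E_{w₀} → K̄_v`** (`IsAlgClosed.lift`; `E_{w₀}/K_v` is finite). [cite: NeukirchANT1999, Ch. II (8.1)] -/
def archBaseEmb :
    haveI := liesOver_of_isOver v (isOver_archBasePlace (E := E) v)
    (archBasePlace (E := E) v).Completion →ₐ[v.Completion] AlgebraicClosure v.Completion :=
  haveI := liesOver_of_isOver v (isOver_archBasePlace (E := E) v)
  haveI := ArchHerbrand.finiteDimensional_completion v (archBasePlace (E := E) v)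
  IsAlgClosed.lift

/-- **The two `K`-embeddings `φ₀|_E` and `ι_v ∘ ιE` of the normal `E` into `K̄_v` differ by an element of `Gal(E/K)`**:
`φ₀ e = ι_v (ιE (σ e))`. [cite: CasselsFrohlichANT1967, Ch. VII §1.1] [cite: NeukirchANT1999, Ch. II (8.1)] -/
theorem exists_algEquiv_archBaseEmb_eq :
    ∃ σ : E ≃ₐ[K] E, ∀ e : E,
      archBaseEmb v (e : (archBasePlace (E := E) v).Completion) = absClosureEmbedding K v.Completion (ιE (σ e)) := by
  haveI := liesOver_of_isOver v (isOver_archBasePlace (E := E) v)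
  let j₁ : E →ₐ[K] AlgebraicClosure v.Completion := (absClosureEmbedding K v.Completion).comp ιE
  let j₂ : E →ₐ[K] AlgebraicClosure v.Completion :=
    { toRingHom := (archBaseEmb (E := E) v : (archBasePlace (E := E) v).Completion →+* AlgebraicClosure v.Completion).comp
        (algebraMap E (archBasePlace (E := E) v).Completion)
      commutes' := fun a => by
        change archBaseEmb (E := E) v (algebraMap K (archBasePlace (E := E) v).Completion a) = _
        rw [IsScalarTower.algebraMap_apply K v.Completion (archBasePlace (E := E) v).Completion, AlgHom.commutes,
          ← IsScalarTower.algebraMap_apply] }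
  letI : Algebra E (AlgebraicClosure v.Completion) := (j₁ : E →+* _).toAlgebra
  haveI : IsScalarTower K E (AlgebraicClosure v.Completion) := IsScalarTower.of_algebraMap_eq fun a => (j₁.commutes a).symm
  refine ⟨j₂.restrictNormal' E, fun x => ?_⟩
  have h := AlgHom.restrictNormal_commutes j₂ E x
  rw [Algebra.algebraMap_self, RingHom.id_apply] at h
  exact h.symm

/-! ## §2. The distinguished place `w_v` and the embedding `E_{w_v} → K̄_v` extending `ι_v ∘ ιE` -/

/-- The correcting element `σ ∈ Gal(E/K)` (`φ₀ e = ι_v ιE (σ e)`). [cite: CasselsFrohlichANT1967, Ch. VII §1.1] -/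
def archCorr : E ≃ₐ[K] E := Classical.choose (exists_algEquiv_archBaseEmb_eq v ιE)

/-- `φ₀ e = ι_v ιE (σ e)`. [cite: CasselsFrohlichANT1967, Ch. VII §1.1] -/
theorem archBaseEmb_coe (e : E) :
    archBaseEmb v (e : (archBasePlace (E := E) v).Completion) = absClosureEmbedding K v.Completion (ιE (archCorr v ιE e)) :=
  Classical.choose_spec (exists_algEquiv_archBaseEmb_eq v ιE) e

/-- **The distinguished infinite place `w_v := σ • w₀` of `E` above `v` cut out by `ι_v ∘ ιE`.**
[cite: CasselsFrohlichANT1967, Ch. VII §1.1] [cite: NeukirchANT1999, Ch. II (8.1)] -/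
def archEmbPlace : InfinitePlace E := archCorr v ιE • archBasePlace (E := E) v

/-- `w_v ∣ v`. [cite: CasselsFrohlichANT1967, Ch. VII §1.1] -/
theorem isOver_archEmbPlace : IsOver E v (archEmbPlace v ιE) :=
  (isOver_smul_iff (archCorr v ιE)).mpr (isOver_archBasePlace v)

/-- `(w_v).comap (algebraMap K E) = v`. [cite: CasselsFrohlichANT1967, Ch. VII §1.1] -/
theorem archEmbPlace_comap : (archEmbPlace v ιE).comap (algebraMap K E) = v := isOver_archEmbPlace v ιE

/-- The `LiesOver` datum of `w_v ∣ v` (makes `E_{w_v}` a `K_v`-algebra, scoped instance of Mathlib). [cite: CasselsFrohlichANT1967, Ch. VII §1.1] -/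
theorem liesOver_archEmbPlace : (archEmbPlace v ιE).1.LiesOver v.1 := liesOver_of_isOver v (isOver_archEmbPlace v ιE)

/-- `σ⁻¹ • w_v = w₀`. [cite: CasselsFrohlichANT1967, Ch. VII §1.1] -/
theorem archCorr_inv_smul_archEmbPlace : (archCorr v ιE)⁻¹ • archEmbPlace v ιE = archBasePlace (E := E) v :=
  inv_smul_smul (archCorr v ιE) _

/-- **The embedding `E_{w_v} → K̄_v`** (`φ₀ ∘ (σ⁻¹)_{w_v}`), as a ring homomorphism.
[cite: NeukirchANT1999, Ch. II (8.1)–(8.3)] [cite: CasselsFrohlichANT1967, Ch. VII §1.1] -/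
def archPlaceEmb : (archEmbPlace v ιE).Completion →+* AlgebraicClosure v.Completion :=
  (archBaseEmb (E := E) v : (archBasePlace (E := E) v).Completion →+* AlgebraicClosure v.Completion).comp
    (galInfiniteCompletionMap (archCorr v ιE)⁻¹ (archCorr_inv_smul_archEmbPlace v ιE))

/-- **`archPlaceEmb` is `K_v`-linear.** [cite: CasselsFrohlichANT1967, Ch. VII §1.1] -/
theorem archPlaceEmb_algebraMap' (x : v.Completion) :
    archPlaceEmb v ιE
        (haveI := liesOver_archEmbPlace v ιE; algebraMap v.Completion (archEmbPlace v ιE).Completion x) =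
      algebraMap v.Completion (AlgebraicClosure v.Completion) x := by
  haveI := liesOver_archEmbPlace v ιE
  haveI := liesOver_of_isOver v (isOver_archBasePlace (E := E) v)
  change archBaseEmb (E := E) v (galInfiniteCompletionMap _ _ _) = _
  rw [galInfiniteCompletionMap_algebraMap_of_isOver v, AlgHom.commutes]

/-- **`archPlaceEmb` as a `K_v`-algebra homomorphism** (under the `LiesOver` datum of `w_v ∣ v`).
[cite: CasselsFrohlichANT1967, Ch. VII §1.1] -/
def archPlaceEmbAlgHom :
    haveI := liesOver_archEmbPlace v ιE
    (archEmbPlace v ιE).Completion →ₐ[v.Completion] AlgebraicClosure v.Completion :=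
  haveI := liesOver_archEmbPlace v ιE
  { toRingHom := archPlaceEmb v ιE
    commutes' := archPlaceEmb_algebraMap' v ιE }

/-- `archPlaceEmbAlgHom` is `archPlaceEmb`. [cite: CasselsFrohlichANT1967, Ch. VII §1.1] -/
theorem archPlaceEmbAlgHom_apply (y : (archEmbPlace v ιE).Completion) : archPlaceEmbAlgHom v ιE y = archPlaceEmb v ιE y :=
  rfl

/-- **`archPlaceEmb` extends `ι_v ∘ ιE`: `archPlaceEmb e = ι_v (ιE e)`.** [cite: NeukirchANT1999, Ch. II (8.1)] -/
theorem archPlaceEmb_coe (e : E) :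
    archPlaceEmb v ιE (e : (archEmbPlace v ιE).Completion) = absClosureEmbedding K v.Completion (ιE e) := by
  change archBaseEmb (E := E) v (galInfiniteCompletionMap _ _ (e : (archEmbPlace v ιE).Completion)) = _
  rw [galInfiniteCompletionMap_coe, archBaseEmb_coe v ιE, AlgEquiv.aut_inv, AlgEquiv.apply_symm_apply]

/-- `archPlaceEmb` is injective. [cite: NeukirchANT1999, Ch. II (8.1)] -/
theorem archPlaceEmb_injective : Function.Injective (archPlaceEmb v ιE) := (archPlaceEmb v ιE).injective

/-! ## §3. Equivariance, surjectivity of `Γ_{K_v} → Stab(w_v)`, image (the engine) -/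

/-- `E_{w_v}/K_v` is normal (door-c6's `isGalois_completion`). [cite: CasselsFrohlichANT1967, Ch. VII §1.1] -/
theorem normal_archEmbPlace_completion :
    haveI := liesOver_archEmbPlace v ιE; Normal v.Completion (archEmbPlace v ιE).Completion :=
  haveI := liesOver_archEmbPlace v ιE
  haveI := ArchHerbrand.isGalois_completion v (archEmbPlace v ιE)
  inferInstance

/-- `archDecompHom` is bijective (door-c6's `archDecompMulEquiv`). [cite: CasselsFrohlichANT1967, Ch. VII §1.1] -/
theorem archDecompHom_bijective :
    haveI := liesOver_archEmbPlace v ιE; Function.Bijective (archDecompHom v (archEmbPlace v ιE)) :=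
  haveI := liesOver_archEmbPlace v ιE
  (archDecompMulEquiv v (archEmbPlace v ιE)).bijective

/-- `archDecompHom` is compatible with `E ⊆ E_{w_v}`: `g_{w_v}(e) = g e`. [cite: CasselsFrohlichANT1967, Ch. VII §1.1] -/
theorem archDecompHom_coe (s : MulAction.stabilizer (E ≃ₐ[K] E) (archEmbPlace v ιE)) (e : E) :
    (haveI := liesOver_archEmbPlace v ιE; archDecompHom v (archEmbPlace v ιE) s)
        ((algebraMap E (archEmbPlace v ιE).Completion : E →+* _) e) =
      (algebraMap E (archEmbPlace v ιE).Completion : E →+* _) ((s : E ≃ₐ[K] E) e) := by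
  haveI := liesOver_archEmbPlace v ιE
  rw [archDecompHom_apply, archDecompAlgEquiv_apply]
  exact galInfiniteCompletionMap_coe K (s : E ≃ₐ[K] E) _ e

/-- **The restriction `d|_E` of `d ∈ Γ_{K_v}` fixes the distinguished place `w_v`.** [cite: CasselsFrohlichANT1967, Ch. VII §1.1, Prop. 1.2] -/
theorem galRestrictField_smul_archEmbPlace (d : absoluteGaloisGroup v.Completion) :
    galRestrictField v.Completion ιE d • archEmbPlace v ιE = archEmbPlace v ιE := by
  haveI := liesOver_archEmbPlace v ιE
  haveI := normal_archEmbPlace_completion v ιE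
  exact MulAction.mem_stabilizer_iff.mp
    (LocalModel.galRestrictField_mem (ιE := ιE) (φ := archPlaceEmbAlgHom v ιE)
      (j := (algebraMap E (archEmbPlace v ιE).Completion : E →+* _)) (δ := archDecompHom v (archEmbPlace v ιE))
      (fun e => archPlaceEmb_coe v ιE e) (archDecompHom_bijective v ιE) (archDecompHom_coe v ιE) d)

/-- **`Γ_{K_v} → Stab(w_v)`**. [cite: CasselsFrohlichANT1967, Ch. VII §1.1] -/
def archGalRestrictStab : absoluteGaloisGroup v.Completion →* MulAction.stabilizer (E ≃ₐ[K] E) (archEmbPlace v ιE) :=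
  (galRestrictField v.Completion ιE).codRestrict _ fun d =>
    MulAction.mem_stabilizer_iff.mpr (galRestrictField_smul_archEmbPlace v ιE d)

/-- `(archGalRestrictStab d : G) = d|_E`. [cite: CasselsFrohlichANT1967, Ch. VII §1.1] -/
@[simp] theorem coe_archGalRestrictStab (d : absoluteGaloisGroup v.Completion) :
    (archGalRestrictStab v ιE d : E ≃ₐ[K] E) = galRestrictField v.Completion ιE d := rfl

/-- **`Γ_{K_v} → Stab(w_v)` is onto.** [cite: CasselsFrohlichANT1967, Ch. VII §1.1, Prop. 1.2] -/
theorem archGalRestrictStab_surjective : Function.Surjective (archGalRestrictStab v ιE) := fun s => by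
  haveI := liesOver_archEmbPlace v ιE
  haveI := normal_archEmbPlace_completion v ιE
  obtain ⟨d, hd⟩ := LocalModel.exists_galRestrictField_eq (ιE := ιE) (φ := archPlaceEmbAlgHom v ιE)
    (j := (algebraMap E (archEmbPlace v ιE).Completion : E →+* _)) (δ := archDecompHom v (archEmbPlace v ιE))
    (fun e => archPlaceEmb_coe v ιE e) (archDecompHom_coe v ιE) s
  exact ⟨d, Subtype.ext hd⟩

/-- **Equivariance: `archPlaceEmb (g_{w_v} y) = d • archPlaceEmb y`** for `g = d|_E` (any proof of `g • w_v = w_v`).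
[cite: CasselsFrohlichANT1967, Ch. VII §1.1] -/
theorem archPlaceEmb_galInfiniteCompletionMap {d : absoluteGaloisGroup v.Completion} {g : E ≃ₐ[K] E}
    (hg : g = galRestrictField v.Completion ιE d) (h : g • archEmbPlace v ιE = archEmbPlace v ιE)
    (y : (archEmbPlace v ιE).Completion) :
    archPlaceEmb v ιE (galInfiniteCompletionMap g h y) = d • archPlaceEmb v ιE y := by
  haveI := liesOver_archEmbPlace v ιE
  haveI := normal_archEmbPlace_completion v ιE
  have key := LocalModel.φ_δ_apply_of_coe_eq (ιE := ιE) (φ := archPlaceEmbAlgHom v ιE)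
    (j := (algebraMap E (archEmbPlace v ιE).Completion : E →+* _)) (δ := archDecompHom v (archEmbPlace v ιE))
    (fun e => archPlaceEmb_coe v ιE e) (archDecompHom_bijective v ιE) (archDecompHom_coe v ιE)
    (s := ⟨g, MulAction.mem_stabilizer_iff.mpr h⟩) hg y
  rw [archDecompHom_apply, archDecompAlgEquiv_apply] at key
  exact key

/-- **The kernel of `d ↦ d|_E` fixes `archPlaceEmb(E_{w_v})` pointwise.** [cite: CasselsFrohlichANT1967, Ch. VII §1.1] -/
theorem smul_archPlaceEmb_of_galRestrictField_eq_one {d : absoluteGaloisGroup v.Completion}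
    (hd : galRestrictField v.Completion ιE d = 1) (y : (archEmbPlace v ιE).Completion) :
    d • archPlaceEmb v ιE y = archPlaceEmb v ιE y := by
  haveI := liesOver_archEmbPlace v ιE
  haveI := normal_archEmbPlace_completion v ιE
  exact LocalModel.smul_φ_of_galRestrictField_eq_one (ιE := ιE) (φ := archPlaceEmbAlgHom v ιE)
    (j := (algebraMap E (archEmbPlace v ιE).Completion : E →+* _)) (δ := archDecompHom v (archEmbPlace v ιE))
    (fun e => archPlaceEmb_coe v ιE e) (archDecompHom_bijective v ιE) (archDecompHom_coe v ιE) hd y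

/-- **An element of `K̄_v` fixed by the kernel of `d ↦ d|_E` lies in `archPlaceEmb(E_{w_v})`.**
[cite: CasselsFrohlichANT1967, Ch. VII §1.1] [cite: NeukirchANT1999, Ch. II (8.3)] -/
theorem exists_archPlaceEmb_eq_of_forall_smul [CharZero K] {x : AlgebraicClosure v.Completion}
    (hx : ∀ d : absoluteGaloisGroup v.Completion, galRestrictField v.Completion ιE d = 1 → d • x = x) :
    ∃ y, archPlaceEmb v ιE y = x := by
  haveI := liesOver_archEmbPlace v ιE
  haveI : CharZero v.Completion := charZero_of_injective_algebraMap (algebraMap K v.Completion).injective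
  exact LocalModel.exists_φ_eq_of_forall_smul (ιE := ιE) (φ := archPlaceEmbAlgHom v ιE)
    (j := (algebraMap E (archEmbPlace v ιE).Completion : E →+* _)) (fun e => archPlaceEmb_coe v ιE e) hx

end IdeleReadout

end Literature.NumberTheory.GaloisRepresentations

end
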